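import Literature.Geometry.Lorentzian.KerrStarHorizonCurrent
import HarnessLib

/-!
# The near-horizon `N`-energy estimate on extremal Kerr in the coordinates `(t*, r, θ, φ*)`:
# Aretakis 2012, §13.1–13.2 on `𝓐_N = {M ≤ r ≤ 23M/21}`, modulo the outer flux and the
# zeroth-order terms

(family `gr`; namespace `Literature.Geometry.Lorentzian.Kerr.StarCoord`; written from the proving
seat of `Literature.Barriers.FinalStateConjecture.Aretakis2012_pointwiseDecay` — Aretakis, JFA 263
(2012), Thm. 5 — whose remaining input, by `ExtremalHorizonPointwiseDecayFromEnergy.lean`, is the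
uniform boundedness of the non-degenerate energy (Thm. 2 of the source) and integrated local energy
decay (Thm. 1). The proof of Thm. 2 (§13.1) integrates the modified current `J^{N,−1/2}` over
`𝓡(0, τ)`; this file carries out that integration on the near-horizon region `𝓐_N` where the
current is non-negative (`KerrStarHorizonCurrent.lean`, Prop. 7.2.1), keeping as explicit terms the
two ingredients of §13.1 that lie outside this file: the flux through the outer cylinder
`{r = 23M/21}` (in the source: extension of `N` by a cut-off `δ`, errors controlled by Thm. 1) and
the zeroth-order terms of the energy (in the source: the Hardy inequalities of §4.4).)

* `box2_integral_mono`, `continuous_lineIntegral_clamped`, `lineIntegral_clamped_eq`,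
  `theta_integral_mono_of_line`, `box2_integral_add`, `box3_integral_mono`, `flux2_integral_sub` —
  monotonicity/additivity of the iterated integrals over `(θ, r)`, `(t, θ, r)`, `(t, θ)` of
  functions continuous on an open set containing the box and compared there (via the clamped
  composites `continuous_clampedComp` of `KerrStarEnergyIdentity.lean`);
* `nEnergyLower`, `nEnergyZeroth`, `nBulkLower` — the coercive quadratic lower bound of the
  `N`-energy density (`nEnergy_quadratic_ge`), its zeroth-order part, and the coercive lower bound of
  the bulk (`neg_multBulk_nCurrent_ge`);
* `nZeroth_poly_nonneg`, `neg_nEnergyZeroth_le` — `−Z ≤ ½ e_low + 27M sin θ G²` on `𝓐_N`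
  (Cauchy–Schwarz; the first step of §13.1, leaving a pure `G²` term for the Hardy inequalities);
* `nEnergy_box_estimate` (**the estimate**): for `G` smooth on an open `W₀ ⊇ [t₁, t₂] × [M, 23M/21] × [0, π]`
  with `𝓡G + 𝓐G = 0` off the axis,
  `∫∫ e_low(t₂) + ∫_{t₁}^{t₂}∫∫ K_low ≤ ∫∫ E_N(t₁) + ∫_{t₁}^{t₂}∫₀^π F_N(t, 23M/21, θ) − ∫∫ Z(t₂)`
  — `mult_box_identity` for `(f, h, w) = (N^Y, N^T − N^Y, −½)` on the box, the horizon flux dropped by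
  `multFluxR_nCurrent_horizon_nonneg`, the energy at `t₂` and the bulk bounded below pointwise.
  Here `e_low = sin θ (M³/8 (∂_rG)² + h(ρ²+2Mr)/16 (∂_{t*}G)² + ½h(∂_θG)²)` is non-degenerate in
  `∂_r` up to the horizon and `K_low = sin θ (¼(r−M)(r+M)(∂_rG)² + 18M²(∂_{t*}G)² + ½(∂_θG)²)`
  degenerates to first order only in the transversal derivative (Prop. 13.2.1: "trapping on `𝓗⁺`").

Everything is proved; no named facts.

## References

* S. Aretakis, *Decay of axisymmetric solutions of the wave equation on extreme Kerr backgrounds*,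
  J. Funct. Anal. 263 (2012) 2770–2831 (arXiv:1110.2006): §13.1 (proof of the uniform boundedness
  of the non-degenerate energy: Stokes for `J^{N,δ,−1/2}` on `𝓡(0, τ)`, signs of the boundary terms,
  the transition region by Thm. 1), Prop. 13.2.1 (`∫_{r ≤ r_e} K^{N,−1/2} ≤ C ∫_{Σ₀} J^N n`), §7.2
  (key `Aretakis2012`).
-/

noncomputable section

open Real Set Filter
open scoped Topology ContDiff

namespace Literature.Geometry.Lorentzian

namespace Kerr

namespace StarCoord

/-! ### Monotonicity of box integrals of functions continuous along the box -/

section BoxMono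

variable {W₀ : Set E4}

/-- Clamping to a degenerate interval. [folklore] -/
private theorem clamp_self (t s : ℝ) : max t (min s t) = t := max_eq_left (min_le_right _ _)

/-- Clamping is the identity on the interval. [folklore] -/
private theorem clamp_eq'' {a b x : ℝ} (hx : x ∈ Icc a b) : max a (min x b) = x := by
  rw [min_eq_left hx.2, max_eq_right hx.1]

/-- **Monotonicity of the `(θ, r)`-box integral at a fixed time** for functions continuous on an
open set containing the box and compared on it. [folklore] -/
theorem box2_integral_mono {F G : E4 → ℝ} (hF : ContinuousOn F W₀) (hG : ContinuousOn G W₀)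
    {t r₁ r₂ φ₀ : ℝ} (hr : r₁ ≤ r₂)
    (hbox : ∀ r ∈ Icc r₁ r₂, ∀ θ ∈ Icc 0 π, boxPoint φ₀ t r θ ∈ W₀)
    (hle : ∀ r ∈ Icc r₁ r₂, ∀ θ ∈ Icc 0 π, F (boxPoint φ₀ t r θ) ≤ G (boxPoint φ₀ t r θ)) :
    (∫ θ in (0 : ℝ)..π, ∫ r in r₁..r₂, F (boxPoint φ₀ t r θ)) ≤
      ∫ θ in (0 : ℝ)..π, ∫ r in r₁..r₂, G (boxPoint φ₀ t r θ) := by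
  have hπ : (0 : ℝ) ≤ π := pi_pos.le
  have hbox' : ∀ s ∈ Icc t t, ∀ r ∈ Icc r₁ r₂, ∀ θ ∈ Icc 0 π, boxPoint φ₀ s r θ ∈ W₀ := by
    intro s hs r hr' θ hθ
    have : s = t := le_antisymm hs.2 hs.1
    rw [this]; exact hbox r hr' θ hθ
  have cF := continuous_clampedComp hF le_rfl hr hbox' (φ₀ := φ₀)
  have cG := continuous_clampedComp hG le_rfl hr hbox' (φ₀ := φ₀)
  simp only [clamp_self] at cF cG
  -- replace the integrands by the clamped ones
  have eF : (∫ θ in (0 : ℝ)..π, ∫ r in r₁..r₂, F (boxPoint φ₀ t r θ)) =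
      ∫ θ in (0 : ℝ)..π, ∫ r in r₁..r₂, F (boxPoint φ₀ t (max r₁ (min r r₂)) (max 0 (min θ π))) := by
    refine intervalIntegral.integral_congr fun θ hθ ↦ ?_
    rw [uIcc_of_le hπ] at hθ
    refine intervalIntegral.integral_congr fun r hr' ↦ ?_
    rw [uIcc_of_le hr] at hr'
    simp only [clamp_eq'' hr', clamp_eq'' hθ]
  have eG : (∫ θ in (0 : ℝ)..π, ∫ r in r₁..r₂, G (boxPoint φ₀ t r θ)) =
      ∫ θ in (0 : ℝ)..π, ∫ r in r₁..r₂, G (boxPoint φ₀ t (max r₁ (min r r₂)) (max 0 (min θ π))) := by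
    refine intervalIntegral.integral_congr fun θ hθ ↦ ?_
    rw [uIcc_of_le hπ] at hθ
    refine intervalIntegral.integral_congr fun r hr' ↦ ?_
    rw [uIcc_of_le hr] at hr'
    simp only [clamp_eq'' hr', clamp_eq'' hθ]
  rw [eF, eG]
  -- slices
  have m_θr : Continuous fun p : ℝ × ℝ ↦ ((t, p.2, p.1) : ℝ × ℝ × ℝ) :=
    Continuous.prodMk continuous_const (Continuous.prodMk continuous_snd continuous_fst)
  have m_r : ∀ θ : ℝ, Continuous fun r : ℝ ↦ ((t, r, θ) : ℝ × ℝ × ℝ) := fun θ ↦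
    Continuous.prodMk continuous_const (Continuous.prodMk continuous_id continuous_const)
  have hIF : Continuous fun θ ↦ ∫ r in r₁..r₂, F (boxPoint φ₀ t (max r₁ (min r r₂)) (max 0 (min θ π))) := by
    have h : Continuous (Function.uncurry fun θ r ↦ F (boxPoint φ₀ t (max r₁ (min r r₂)) (max 0 (min θ π)))) :=
      cF.comp m_θr
    exact intervalIntegral.continuous_parametric_intervalIntegral_of_continuous' h r₁ r₂
  have hIG : Continuous fun θ ↦ ∫ r in r₁..r₂, G (boxPoint φ₀ t (max r₁ (min r r₂)) (max 0 (min θ π))) := by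
    have h : Continuous (Function.uncurry fun θ r ↦ G (boxPoint φ₀ t (max r₁ (min r r₂)) (max 0 (min θ π)))) :=
      cG.comp m_θr
    exact intervalIntegral.continuous_parametric_intervalIntegral_of_continuous' h r₁ r₂
  refine intervalIntegral.integral_mono_on hπ (hIF.intervalIntegrable _ _) (hIG.intervalIntegrable _ _)
    fun θ hθ ↦ ?_
  have cFr : Continuous fun r ↦ F (boxPoint φ₀ t (max r₁ (min r r₂)) (max 0 (min θ π))) := cF.comp (m_r θ)
  have cGr : Continuous fun r ↦ G (boxPoint φ₀ t (max r₁ (min r r₂)) (max 0 (min θ π))) := cG.comp (m_r θ)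
  refine intervalIntegral.integral_mono_on hr (cFr.intervalIntegrable _ _) (cGr.intervalIntegrable _ _)
    fun r hr' ↦ ?_
  simp only [clamp_eq'' hr', clamp_eq'' hθ]
  exact hle r hr' θ hθ

/-- The clamped line integral `θ ↦ ∫_{r₁}^{r₂} F(p(t, r, clamp θ)) dr` is continuous, for `F`
continuous on an open set containing the lines. [folklore] -/
theorem continuous_lineIntegral_clamped {F : E4 → ℝ} (hF : ContinuousOn F W₀)
    {t r₁ r₂ φ₀ : ℝ} (hr : r₁ ≤ r₂)
    (hbox : ∀ r ∈ Icc r₁ r₂, ∀ θ ∈ Icc 0 π, boxPoint φ₀ t r θ ∈ W₀) :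
    Continuous fun θ ↦ ∫ r in r₁..r₂, F (boxPoint φ₀ t (max r₁ (min r r₂)) (max 0 (min θ π))) := by
  have hbox' : ∀ s ∈ Icc t t, ∀ r ∈ Icc r₁ r₂, ∀ θ ∈ Icc 0 π, boxPoint φ₀ s r θ ∈ W₀ := by
    intro s hs r hr' θ hθ
    have : s = t := le_antisymm hs.2 hs.1
    rw [this]; exact hbox r hr' θ hθ
  have cF := continuous_clampedComp hF le_rfl hr hbox' (φ₀ := φ₀)
  simp only [clamp_self] at cF
  have m_θr : Continuous fun p : ℝ × ℝ ↦ ((t, p.2, p.1) : ℝ × ℝ × ℝ) :=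
    Continuous.prodMk continuous_const (Continuous.prodMk continuous_snd continuous_fst)
  have h : Continuous (Function.uncurry fun θ r ↦ F (boxPoint φ₀ t (max r₁ (min r r₂)) (max 0 (min θ π)))) :=
    cF.comp m_θr
  exact intervalIntegral.continuous_parametric_intervalIntegral_of_continuous' h r₁ r₂

/-- On `[0, π]` the clamped line integral is the line integral. [folklore] -/
theorem lineIntegral_clamped_eq (F : E4 → ℝ) {t r₁ r₂ φ₀ θ : ℝ} (hr : r₁ ≤ r₂) (hθ : θ ∈ Icc 0 π) :
    (∫ r in r₁..r₂, F (boxPoint φ₀ t (max r₁ (min r r₂)) (max 0 (min θ π)))) =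
      ∫ r in r₁..r₂, F (boxPoint φ₀ t r θ) := by
  refine intervalIntegral.integral_congr fun r hr' ↦ ?_
  rw [uIcc_of_le hr] at hr'
  simp only [clamp_eq'' hr', clamp_eq'' hθ]

/-- **Integrating a linewise inequality over `θ ∈ [0, π]`**: if for every `θ` the `r`-line
integral of `F` (at time `t`, over `[a₁, b₁]`) is at most that of `G` (at time `t'`, over
`[a₂, b₂]`), the same holds after integration in `θ` (functions continuous on an open set containing
the lines). [folklore] -/
theorem theta_integral_mono_of_line {F G : E4 → ℝ} (hF : ContinuousOn F W₀) (hG : ContinuousOn G W₀)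
    {t t' a₁ b₁ a₂ b₂ φ₀ : ℝ} (h₁ : a₁ ≤ b₁) (h₂ : a₂ ≤ b₂)
    (hbox₁ : ∀ r ∈ Icc a₁ b₁, ∀ θ ∈ Icc 0 π, boxPoint φ₀ t r θ ∈ W₀)
    (hbox₂ : ∀ r ∈ Icc a₂ b₂, ∀ θ ∈ Icc 0 π, boxPoint φ₀ t' r θ ∈ W₀)
    (hle : ∀ θ ∈ Icc 0 π, (∫ r in a₁..b₁, F (boxPoint φ₀ t r θ)) ≤ ∫ r in a₂..b₂, G (boxPoint φ₀ t' r θ)) :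
    (∫ θ in (0 : ℝ)..π, ∫ r in a₁..b₁, F (boxPoint φ₀ t r θ)) ≤
      ∫ θ in (0 : ℝ)..π, ∫ r in a₂..b₂, G (boxPoint φ₀ t' r θ) := by
  have hπ : (0 : ℝ) ≤ π := pi_pos.le
  have cF := continuous_lineIntegral_clamped hF h₁ hbox₁
  have cG := continuous_lineIntegral_clamped hG h₂ hbox₂
  have eF : (∫ θ in (0 : ℝ)..π, ∫ r in a₁..b₁, F (boxPoint φ₀ t r θ)) =
      ∫ θ in (0 : ℝ)..π, ∫ r in a₁..b₁, F (boxPoint φ₀ t (max a₁ (min r b₁)) (max 0 (min θ π))) := by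
    refine intervalIntegral.integral_congr fun θ hθ ↦ ?_
    rw [uIcc_of_le hπ] at hθ
    exact (lineIntegral_clamped_eq F h₁ hθ).symm
  have eG : (∫ θ in (0 : ℝ)..π, ∫ r in a₂..b₂, G (boxPoint φ₀ t' r θ)) =
      ∫ θ in (0 : ℝ)..π, ∫ r in a₂..b₂, G (boxPoint φ₀ t' (max a₂ (min r b₂)) (max 0 (min θ π))) := by
    refine intervalIntegral.integral_congr fun θ hθ ↦ ?_
    rw [uIcc_of_le hπ] at hθ
    exact (lineIntegral_clamped_eq G h₂ hθ).symm
  rw [eF, eG]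
  refine intervalIntegral.integral_mono_on hπ (cF.intervalIntegrable _ _) (cG.intervalIntegrable _ _)
    fun θ hθ ↦ ?_
  rw [lineIntegral_clamped_eq F h₁ hθ, lineIntegral_clamped_eq G h₂ hθ]
  exact hle θ hθ

/-- **Additivity of the `(θ, r)`-box integral at a fixed time** for functions continuous on an
open set containing the box. [folklore] -/
theorem box2_integral_add {F G : E4 → ℝ} (hF : ContinuousOn F W₀) (hG : ContinuousOn G W₀)
    {t r₁ r₂ φ₀ : ℝ} (hr : r₁ ≤ r₂)
    (hbox : ∀ r ∈ Icc r₁ r₂, ∀ θ ∈ Icc 0 π, boxPoint φ₀ t r θ ∈ W₀) :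
    (∫ θ in (0 : ℝ)..π, ∫ r in r₁..r₂, (F (boxPoint φ₀ t r θ) + G (boxPoint φ₀ t r θ))) =
      (∫ θ in (0 : ℝ)..π, ∫ r in r₁..r₂, F (boxPoint φ₀ t r θ)) +
        ∫ θ in (0 : ℝ)..π, ∫ r in r₁..r₂, G (boxPoint φ₀ t r θ) := by
  have hπ : (0 : ℝ) ≤ π := pi_pos.le
  have hbox' : ∀ s ∈ Icc t t, ∀ r ∈ Icc r₁ r₂, ∀ θ ∈ Icc 0 π, boxPoint φ₀ s r θ ∈ W₀ := by
    intro s hs r hr' θ hθ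
    have : s = t := le_antisymm hs.2 hs.1
    rw [this]; exact hbox r hr' θ hθ
  have cF := continuous_clampedComp hF le_rfl hr hbox' (φ₀ := φ₀)
  have cG := continuous_clampedComp hG le_rfl hr hbox' (φ₀ := φ₀)
  simp only [clamp_self] at cF cG
  have eq2 : ∀ (H : E4 → ℝ), (∫ θ in (0 : ℝ)..π, ∫ r in r₁..r₂, H (boxPoint φ₀ t r θ)) =
      ∫ θ in (0 : ℝ)..π, ∫ r in r₁..r₂, H (boxPoint φ₀ t (max r₁ (min r r₂)) (max 0 (min θ π))) := by
    intro H
    refine intervalIntegral.integral_congr fun θ hθ ↦ ?_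
    rw [uIcc_of_le hπ] at hθ
    refine intervalIntegral.integral_congr fun r hr' ↦ ?_
    rw [uIcc_of_le hr] at hr'
    simp only [clamp_eq'' hr', clamp_eq'' hθ]
  rw [eq2 (fun q ↦ F q + G q), eq2 F, eq2 G]
  have m_θr : Continuous fun p : ℝ × ℝ ↦ ((t, p.2, p.1) : ℝ × ℝ × ℝ) :=
    Continuous.prodMk continuous_const (Continuous.prodMk continuous_snd continuous_fst)
  have m_r : ∀ θ : ℝ, Continuous fun r : ℝ ↦ ((t, r, θ) : ℝ × ℝ × ℝ) := fun θ ↦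
    Continuous.prodMk continuous_const (Continuous.prodMk continuous_id continuous_const)
  have hIF : Continuous fun θ ↦ ∫ r in r₁..r₂, F (boxPoint φ₀ t (max r₁ (min r r₂)) (max 0 (min θ π))) := by
    have h : Continuous (Function.uncurry fun θ r ↦ F (boxPoint φ₀ t (max r₁ (min r r₂)) (max 0 (min θ π)))) :=
      cF.comp m_θr
    exact intervalIntegral.continuous_parametric_intervalIntegral_of_continuous' h r₁ r₂
  have hIG : Continuous fun θ ↦ ∫ r in r₁..r₂, G (boxPoint φ₀ t (max r₁ (min r r₂)) (max 0 (min θ π))) := by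
    have h : Continuous (Function.uncurry fun θ r ↦ G (boxPoint φ₀ t (max r₁ (min r r₂)) (max 0 (min θ π)))) :=
      cG.comp m_θr
    exact intervalIntegral.continuous_parametric_intervalIntegral_of_continuous' h r₁ r₂
  rw [← intervalIntegral.integral_add (hIF.intervalIntegrable _ _) (hIG.intervalIntegrable _ _)]
  refine intervalIntegral.integral_congr fun θ _ ↦ ?_
  exact intervalIntegral.integral_add ((cF.comp (m_r θ)).intervalIntegrable _ _)
    ((cG.comp (m_r θ)).intervalIntegrable _ _)

/-- **Monotonicity of the `(t, θ, r)`-box integral** for functions continuous on an open set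
containing the box and compared on it. [folklore] -/
theorem box3_integral_mono {F G : E4 → ℝ} (hF : ContinuousOn F W₀) (hG : ContinuousOn G W₀)
    {t₁ t₂ r₁ r₂ φ₀ : ℝ} (ht : t₁ ≤ t₂) (hr : r₁ ≤ r₂)
    (hbox : ∀ t ∈ Icc t₁ t₂, ∀ r ∈ Icc r₁ r₂, ∀ θ ∈ Icc 0 π, boxPoint φ₀ t r θ ∈ W₀)
    (hle : ∀ t ∈ Icc t₁ t₂, ∀ r ∈ Icc r₁ r₂, ∀ θ ∈ Icc 0 π, F (boxPoint φ₀ t r θ) ≤ G (boxPoint φ₀ t r θ)) :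
    (∫ t in t₁..t₂, ∫ θ in (0 : ℝ)..π, ∫ r in r₁..r₂, F (boxPoint φ₀ t r θ)) ≤
      ∫ t in t₁..t₂, ∫ θ in (0 : ℝ)..π, ∫ r in r₁..r₂, G (boxPoint φ₀ t r θ) := by
  have hπ : (0 : ℝ) ≤ π := pi_pos.le
  have cF := continuous_clampedComp hF ht hr hbox (φ₀ := φ₀)
  have cG := continuous_clampedComp hG ht hr hbox (φ₀ := φ₀)
  -- clamped versions and their equality with the originals on the box
  have eq3 : ∀ (H : E4 → ℝ), (∫ t in t₁..t₂, ∫ θ in (0 : ℝ)..π, ∫ r in r₁..r₂, H (boxPoint φ₀ t r θ)) =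
      ∫ t in t₁..t₂, ∫ θ in (0 : ℝ)..π, ∫ r in r₁..r₂,
        H (boxPoint φ₀ (max t₁ (min t t₂)) (max r₁ (min r r₂)) (max 0 (min θ π))) := by
    intro H
    refine intervalIntegral.integral_congr fun t ht' ↦ ?_
    rw [uIcc_of_le ht] at ht'
    refine intervalIntegral.integral_congr fun θ hθ ↦ ?_
    rw [uIcc_of_le hπ] at hθ
    refine intervalIntegral.integral_congr fun r hr' ↦ ?_
    rw [uIcc_of_le hr] at hr'
    simp only [clamp_eq'' hr', clamp_eq'' hθ, clamp_eq'' ht']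
  rw [eq3 F, eq3 G]
  -- continuity of the inner integrals
  have hin : ∀ {H : E4 → ℝ}, (Continuous fun p : ℝ × ℝ × ℝ ↦
      H (boxPoint φ₀ (max t₁ (min p.1 t₂)) (max r₁ (min p.2.1 r₂)) (max 0 (min p.2.2 π)))) →
      Continuous fun p : ℝ × ℝ ↦ ∫ r in r₁..r₂,
        H (boxPoint φ₀ (max t₁ (min p.1 t₂)) (max r₁ (min r r₂)) (max 0 (min p.2 π))) := by
    intro H cH
    have m : Continuous fun q : (ℝ × ℝ) × ℝ ↦ ((q.1.1, q.2, q.1.2) : ℝ × ℝ × ℝ) :=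
      Continuous.prodMk (continuous_fst.comp continuous_fst) (Continuous.prodMk continuous_snd
        (continuous_snd.comp continuous_fst))
    have h : Continuous (Function.uncurry fun (p : ℝ × ℝ) r ↦
        H (boxPoint φ₀ (max t₁ (min p.1 t₂)) (max r₁ (min r r₂)) (max 0 (min p.2 π)))) := cH.comp m
    exact intervalIntegral.continuous_parametric_intervalIntegral_of_continuous' h r₁ r₂
  have hmid : ∀ {H : E4 → ℝ}, (Continuous fun p : ℝ × ℝ × ℝ ↦
      H (boxPoint φ₀ (max t₁ (min p.1 t₂)) (max r₁ (min p.2.1 r₂)) (max 0 (min p.2.2 π)))) →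
      Continuous fun t ↦ ∫ θ in (0 : ℝ)..π, ∫ r in r₁..r₂,
        H (boxPoint φ₀ (max t₁ (min t t₂)) (max r₁ (min r r₂)) (max 0 (min θ π))) := by
    intro H cH
    have h : Continuous (Function.uncurry fun t θ ↦ ∫ r in r₁..r₂,
        H (boxPoint φ₀ (max t₁ (min t t₂)) (max r₁ (min r r₂)) (max 0 (min θ π)))) := hin cH
    exact intervalIntegral.continuous_parametric_intervalIntegral_of_continuous' h 0 π
  refine intervalIntegral.integral_mono_on ht ((hmid cF).intervalIntegrable _ _)
    ((hmid cG).intervalIntegrable _ _) fun t ht' ↦ ?_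
  have mt : Continuous fun θ : ℝ ↦ ((t, θ) : ℝ × ℝ) := Continuous.prodMk continuous_const continuous_id
  refine intervalIntegral.integral_mono_on hπ (((hin cF).comp mt).intervalIntegrable _ _)
    (((hin cG).comp mt).intervalIntegrable _ _) fun θ hθ ↦ ?_
  have mr : Continuous fun r : ℝ ↦ ((t, r, θ) : ℝ × ℝ × ℝ) :=
    Continuous.prodMk continuous_const (Continuous.prodMk continuous_id continuous_const)
  refine intervalIntegral.integral_mono_on hr ((cF.comp mr).intervalIntegrable _ _)
    ((cG.comp mr).intervalIntegrable _ _) fun r hr' ↦ ?_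
  simp only [clamp_eq'' hr', clamp_eq'' hθ, clamp_eq'' ht']
  exact hle t ht' r hr' θ hθ

/-- **The time-integrated flux difference splits**: for `F` continuous on an open set containing
the box, `∫∫ (F(t, r₂, θ) − F(t, r₁, θ)) = ∫∫ F(t, r₂, θ) − ∫∫ F(t, r₁, θ)`. [folklore] -/
theorem flux2_integral_sub {F : E4 → ℝ} (hF : ContinuousOn F W₀)
    {t₁ t₂ r₁ r₂ φ₀ : ℝ} (ht : t₁ ≤ t₂) (hr : r₁ ≤ r₂)
    (hbox : ∀ t ∈ Icc t₁ t₂, ∀ r ∈ Icc r₁ r₂, ∀ θ ∈ Icc 0 π, boxPoint φ₀ t r θ ∈ W₀) :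
    (∫ t in t₁..t₂, ∫ θ in (0 : ℝ)..π, (F (boxPoint φ₀ t r₂ θ) - F (boxPoint φ₀ t r₁ θ))) =
      (∫ t in t₁..t₂, ∫ θ in (0 : ℝ)..π, F (boxPoint φ₀ t r₂ θ)) -
        ∫ t in t₁..t₂, ∫ θ in (0 : ℝ)..π, F (boxPoint φ₀ t r₁ θ) := by
  have hπ : (0 : ℝ) ≤ π := pi_pos.le
  have cF := continuous_clampedComp hF ht hr hbox (φ₀ := φ₀)
  have hr₁ : max r₁ (min r₁ r₂) = r₁ := clamp_eq'' (left_mem_Icc.mpr hr)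
  have hr₂ : max r₁ (min r₂ r₂) = r₂ := clamp_eq'' (right_mem_Icc.mpr hr)
  -- the two slices, globally continuous
  have m₂ : Continuous fun p : ℝ × ℝ ↦ ((p.1, r₂, p.2) : ℝ × ℝ × ℝ) :=
    Continuous.prodMk continuous_fst (Continuous.prodMk continuous_const continuous_snd)
  have m₁ : Continuous fun p : ℝ × ℝ ↦ ((p.1, r₁, p.2) : ℝ × ℝ × ℝ) :=
    Continuous.prodMk continuous_fst (Continuous.prodMk continuous_const continuous_snd)
  have c₂ : Continuous fun p : ℝ × ℝ ↦ F (boxPoint φ₀ (max t₁ (min p.1 t₂)) r₂ (max 0 (min p.2 π))) := by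
    have h := cF.comp m₂
    simp only [Function.comp_def, hr₂] at h
    exact h
  have c₁ : Continuous fun p : ℝ × ℝ ↦ F (boxPoint φ₀ (max t₁ (min p.1 t₂)) r₁ (max 0 (min p.2 π))) := by
    have h := cF.comp m₁
    simp only [Function.comp_def, hr₁] at h
    exact h
  have eq2 : ∀ (ρ : ℝ), (∫ t in t₁..t₂, ∫ θ in (0 : ℝ)..π, F (boxPoint φ₀ t ρ θ)) =
      ∫ t in t₁..t₂, ∫ θ in (0 : ℝ)..π, F (boxPoint φ₀ (max t₁ (min t t₂)) ρ (max 0 (min θ π))) := by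
    intro ρ
    refine intervalIntegral.integral_congr fun t ht' ↦ ?_
    rw [uIcc_of_le ht] at ht'
    refine intervalIntegral.integral_congr fun θ hθ ↦ ?_
    rw [uIcc_of_le hπ] at hθ
    simp only [clamp_eq'' ht', clamp_eq'' hθ]
  have eqd : (∫ t in t₁..t₂, ∫ θ in (0 : ℝ)..π, (F (boxPoint φ₀ t r₂ θ) - F (boxPoint φ₀ t r₁ θ))) =
      ∫ t in t₁..t₂, ∫ θ in (0 : ℝ)..π, (F (boxPoint φ₀ (max t₁ (min t t₂)) r₂ (max 0 (min θ π))) -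
        F (boxPoint φ₀ (max t₁ (min t t₂)) r₁ (max 0 (min θ π)))) := by
    refine intervalIntegral.integral_congr fun t ht' ↦ ?_
    rw [uIcc_of_le ht] at ht'
    refine intervalIntegral.integral_congr fun θ hθ ↦ ?_
    rw [uIcc_of_le hπ] at hθ
    simp only [clamp_eq'' ht', clamp_eq'' hθ]
  rw [eqd, eq2 r₂, eq2 r₁]
  have mt : ∀ t : ℝ, Continuous fun θ : ℝ ↦ ((t, θ) : ℝ × ℝ) := fun t ↦ Continuous.prodMk continuous_const continuous_id
  have hI₂ : Continuous fun t ↦ ∫ θ in (0 : ℝ)..π, F (boxPoint φ₀ (max t₁ (min t t₂)) r₂ (max 0 (min θ π))) :=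
    intervalIntegral.continuous_parametric_intervalIntegral_of_continuous' c₂ 0 π
  have hI₁ : Continuous fun t ↦ ∫ θ in (0 : ℝ)..π, F (boxPoint φ₀ (max t₁ (min t t₂)) r₁ (max 0 (min θ π))) :=
    intervalIntegral.continuous_parametric_intervalIntegral_of_continuous' c₁ 0 π
  rw [← intervalIntegral.integral_sub (hI₂.intervalIntegrable _ _) (hI₁.intervalIntegrable _ _)]
  refine intervalIntegral.integral_congr fun t _ ↦ ?_
  exact intervalIntegral.integral_sub ((c₂.comp (mt t)).intervalIntegrable _ _)
    ((c₁.comp (mt t)).intervalIntegrable _ _)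

end BoxMono

/-! ### The near-horizon `N`-energy estimate -/

section Estimate

variable {M : ℝ}

/-- The coercive lower bound for the `N`-energy density (quadratic part), from `nEnergy_quadratic_ge`.
[cite: Aretakis2012, §7.2] -/
def nEnergyLower (M : ℝ) (G : E4 → ℝ) : E4 → ℝ := fun q ↦
  sin (q 2) * (M ^ 3 / 8 * pd 1 G q ^ 2 +
    (20 * q 1 - 37 / 2 * M) * (q 1 ^ 2 + M ^ 2 * cos (q 2) ^ 2 + 2 * M * q 1) / 16 * pd 0 G q ^ 2 +
    1 / 2 * (20 * q 1 - 37 / 2 * M) * pd 2 G q ^ 2)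

/-- The zeroth-order part of the `N`-energy density (to be absorbed by the Hardy inequalities).
[cite: Aretakis2012, §13.1] -/
def nEnergyZeroth (M : ℝ) (G : E4 → ℝ) : E4 → ℝ := fun q ↦
  1 / 2 * sin (q 2) * (4 * M * q 1 * G q * pd 1 G q + M * G q ^ 2 -
    (q 1 ^ 2 + M ^ 2 * cos (q 2) ^ 2 + 2 * M * q 1) * G q * pd 0 G q)

/-- The coercive lower bound for the bulk `K^{N,−1/2} ρ² sin θ = −multBulk`, from
`neg_multBulk_nCurrent_ge`. [cite: Aretakis2012, §7.2 (Prop. 7.2.1)] -/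
def nBulkLower (M : ℝ) (G : E4 → ℝ) : E4 → ℝ := fun q ↦
  sin (q 2) * (1 / 4 * (q 1 - M) * (q 1 + M) * pd 1 G q ^ 2 + 18 * M ^ 2 * pd 0 G q ^ 2 +
    1 / 2 * pd 2 G q ^ 2)

/-- Polynomial certificate for absorbing the zeroth-order terms: on `𝓐_N` (`M ≤ r ≤ 23M/21`,
`M > 0`), for all reals `g, g₀, g₁, g₂` and `c² ≤ 1`,
`0 ≤ (M³/16) g₁² + (hΣ/32) g₀² + (h/4) g₂² + 27M g² + 2Mr g g₁ + ½M g² − ½Σ g g₀`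
(`h = 20r − 37M/2`, `Σ = r² + M²c² + 2Mr`). [folklore] -/
theorem nZeroth_poly_nonneg {M r c : ℝ} (hM : 0 < M) (hr₁ : M ≤ r) (hr₂ : r ≤ 23 / 21 * M)
    (hc : c ^ 2 ≤ 1) (g g₀ g₁ g₂ : ℝ) :
    0 ≤ M ^ 3 / 16 * g₁ ^ 2 + (20 * r - 37 / 2 * M) * (r ^ 2 + M ^ 2 * c ^ 2 + 2 * M * r) / 32 * g₀ ^ 2 +
      (20 * r - 37 / 2 * M) / 4 * g₂ ^ 2 + 27 * M * g ^ 2 + 2 * M * r * g * g₁ + 1 / 2 * M * g ^ 2 -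
      1 / 2 * (r ^ 2 + M ^ 2 * c ^ 2 + 2 * M * r) * g * g₀ := by
  have hh : 3 / 2 * M ≤ 20 * r - 37 / 2 * M := by linarith
  have hhpos : 0 < 20 * r - 37 / 2 * M := by linarith
  have hc0 : 0 ≤ c ^ 2 := sq_nonneg c
  have hSpos : 0 < r ^ 2 + M ^ 2 * c ^ 2 + 2 * M * r := by nlinarith
  have hSle : r ^ 2 + M ^ 2 * c ^ 2 + 2 * M * r ≤ 22 / 5 * M ^ 2 := by nlinarith
  have hr2 : 256 * r ^ 2 ≤ 320 * M ^ 2 := by nlinarith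
  -- piece 1: `(M³/16) g₁² + 2Mr g g₁ + 20M g² ≥ 0` from `16M·(…) = (M²g₁ + 16rg)² + (320M² − 256r²)g²`
  have p1 : 0 ≤ M ^ 3 / 16 * g₁ ^ 2 + 2 * M * r * g * g₁ + 20 * M * g ^ 2 := by
    have h16 : 0 ≤ 16 * M * (M ^ 3 / 16 * g₁ ^ 2 + 2 * M * r * g * g₁ + 20 * M * g ^ 2) := by
      have : 16 * M * (M ^ 3 / 16 * g₁ ^ 2 + 2 * M * r * g * g₁ + 20 * M * g ^ 2) =
          (M ^ 2 * g₁ + 16 * r * g) ^ 2 + (320 * M ^ 2 - 256 * r ^ 2) * g ^ 2 := by ring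
      rw [this]; nlinarith [sq_nonneg (M ^ 2 * g₁ + 16 * r * g), sq_nonneg g]
    nlinarith
  -- piece 2: `(hΣ/32) g₀² − ½Σ g g₀ + 7M g² ≥ 0` from `32h·(…) = Σ(hg₀ − 8g)² + (224Mh − 64Σ)g²`
  have p2 : 0 ≤ (20 * r - 37 / 2 * M) * (r ^ 2 + M ^ 2 * c ^ 2 + 2 * M * r) / 32 * g₀ ^ 2 -
      1 / 2 * (r ^ 2 + M ^ 2 * c ^ 2 + 2 * M * r) * g * g₀ + 7 * M * g ^ 2 := by
    have h32 : 0 ≤ 32 * (20 * r - 37 / 2 * M) *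
        ((20 * r - 37 / 2 * M) * (r ^ 2 + M ^ 2 * c ^ 2 + 2 * M * r) / 32 * g₀ ^ 2 -
          1 / 2 * (r ^ 2 + M ^ 2 * c ^ 2 + 2 * M * r) * g * g₀ + 7 * M * g ^ 2) := by
      have : 32 * (20 * r - 37 / 2 * M) *
          ((20 * r - 37 / 2 * M) * (r ^ 2 + M ^ 2 * c ^ 2 + 2 * M * r) / 32 * g₀ ^ 2 -
            1 / 2 * (r ^ 2 + M ^ 2 * c ^ 2 + 2 * M * r) * g * g₀ + 7 * M * g ^ 2) =
          (r ^ 2 + M ^ 2 * c ^ 2 + 2 * M * r) * ((20 * r - 37 / 2 * M) * g₀ - 8 * g) ^ 2 +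
            (224 * M * (20 * r - 37 / 2 * M) - 64 * (r ^ 2 + M ^ 2 * c ^ 2 + 2 * M * r)) * g ^ 2 := by
        ring
      rw [this]
      have hcoef : 0 ≤ 224 * M * (20 * r - 37 / 2 * M) - 64 * (r ^ 2 + M ^ 2 * c ^ 2 + 2 * M * r) := by
        nlinarith
      nlinarith [mul_nonneg hSpos.le (sq_nonneg ((20 * r - 37 / 2 * M) * g₀ - 8 * g)),
        mul_nonneg hcoef (sq_nonneg g)]
    nlinarith
  -- piece 3
  have p3 : 0 ≤ (20 * r - 37 / 2 * M) / 4 * g₂ ^ 2 + 1 / 2 * M * g ^ 2 := by positivity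
  linarith

/-- **Absorbing the zeroth-order terms (the first step of §13.1):** on `𝓐_N`, for `θ ∈ [0, π]`,
`−Z ≤ ½ e_low + 27 M sin θ G²` — Cauchy–Schwarz with the weights of `nEnergyLower`; the `G²` term
is the one handled in the source by the Hardy inequalities (4.1), (4.2).
[cite: Aretakis2012, §13.1] -/
theorem neg_nEnergyZeroth_le (hM : 0 < M) (G : E4 → ℝ) {q : E4} (hr₁ : M ≤ q 1)
    (hr₂ : q 1 ≤ 23 / 21 * M) (hθ : q 2 ∈ Icc 0 π) :
    -nEnergyZeroth M G q ≤ 1 / 2 * nEnergyLower M G q + 27 * M * (sin (q 2) * G q ^ 2) := by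
  have hs : 0 ≤ sin (q 2) := sin_nonneg_of_nonneg_of_le_pi hθ.1 hθ.2
  have hc : cos (q 2) ^ 2 ≤ 1 := by rw [sq_le_one_iff_abs_le_one]; exact abs_cos_le_one _
  have hp := nZeroth_poly_nonneg hM hr₁ hr₂ hc (G q) (pd 0 G q) (pd 1 G q) (pd 2 G q)
  have key : 1 / 2 * nEnergyLower M G q + 27 * M * (sin (q 2) * G q ^ 2) + nEnergyZeroth M G q =
      sin (q 2) * (M ^ 3 / 16 * pd 1 G q ^ 2 +
        (20 * q 1 - 37 / 2 * M) * (q 1 ^ 2 + M ^ 2 * cos (q 2) ^ 2 + 2 * M * q 1) / 32 * pd 0 G q ^ 2 +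
        (20 * q 1 - 37 / 2 * M) / 4 * pd 2 G q ^ 2 + 27 * M * G q ^ 2 + 2 * M * q 1 * G q * pd 1 G q +
        1 / 2 * M * G q ^ 2 - 1 / 2 * (q 1 ^ 2 + M ^ 2 * cos (q 2) ^ 2 + 2 * M * q 1) * G q * pd 0 G q) := by
    simp only [nEnergyLower, nEnergyZeroth]; ring
  nlinarith [mul_nonneg hs hp, key]

/-- **The near-horizon `N`-energy estimate in coordinates (Aretakis 2012, §13.1–13.2 on `𝓐_N`).**
Let `G` be smooth on an open `W₀` containing the box `[t₁, t₂] × [M, 23M/21] × [0, π]` (at `φ₀`)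
and satisfy `𝓡G + 𝓐G = 0` off the axis (an axisymmetric solution of the Kerr wave equation on
extremal Kerr `a = M > 0`, pulled back by the Kerr-star chart). Then, with the modified current
`J^{N,−1/2}` of `KerrStarHorizonCurrent.lean`:
`∫∫ e_low(t₂) + ∫_{t₁}^{t₂}∫∫ K_low ≤ ∫∫ E_N(t₁) + ∫_{t₁}^{t₂}∫₀^π F_N(t, 23M/21, θ) dθ dt − ∫∫ Z(t₂)`,
where `E_N = −multDensity` is the `N`-energy density, `e_low` (`nEnergyLower`) the coercive quadratic
lower bound of `nEnergy_quadratic_ge` (non-degenerate in `∂_r` up to `𝓗⁺`), `K_low` (`nBulkLower`)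
the coercive lower bound of Prop. 7.2.1 (`neg_multBulk_nCurrent_ge`), `Z` (`nEnergyZeroth`) the
zeroth-order part of `E_N(t₂)`, and `F_N(·, 23M/21, ·)` the flux through the outer cylinder of
`𝓐_N` — the energy identity `mult_box_identity` for `(f, h, w) = (N^Y, N^T − N^Y, −½)` on the box,
with the horizon flux dropped by its sign (`multFluxR_nCurrent_horizon_nonneg`). In the source the
outer flux is handled by extending `N` with a cut-off and the integrated decay estimate (Thm. 1),
and `Z` by the Hardy inequalities (§4.4). [cite: Aretakis2012, §13.1 and Prop. 13.2.1] -/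
theorem nEnergy_box_estimate (hM : 0 < M) {W₀ : Set E4} (hW₀ : IsOpen W₀) {G : E4 → ℝ}
    (hG : ContDiffOn ℝ ∞ G W₀) (hP : ∀ q ∈ W₀, sin (q 2) ≠ 0 → radOp M M G q + angOp M G q = 0)
    {t₁ t₂ φ₀ : ℝ} (ht : t₁ ≤ t₂)
    (hbox : ∀ t ∈ Icc t₁ t₂, ∀ r ∈ Icc M (23 / 21 * M), ∀ θ ∈ Icc 0 π, boxPoint φ₀ t r θ ∈ W₀) :
    (∫ θ in (0 : ℝ)..π, ∫ r in M..(23 / 21 * M), nEnergyLower M G (boxPoint φ₀ t₂ r θ)) +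
        (∫ t in t₁..t₂, ∫ θ in (0 : ℝ)..π, ∫ r in M..(23 / 21 * M), nBulkLower M G (boxPoint φ₀ t r θ)) ≤
      (∫ θ in (0 : ℝ)..π, ∫ r in M..(23 / 21 * M),
          -multDensity M M (nProfileR M) (nProfileT M) nProfileW G (boxPoint φ₀ t₁ r θ)) +
        (∫ t in t₁..t₂, ∫ θ in (0 : ℝ)..π,
          multFluxR M M (nProfileR M) (nProfileT M) nProfileW G (boxPoint φ₀ t (23 / 21 * M) θ)) -
        ∫ θ in (0 : ℝ)..π, ∫ r in M..(23 / 21 * M), nEnergyZeroth M G (boxPoint φ₀ t₂ r θ) := by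
  have hπ : (0 : ℝ) ≤ π := pi_pos.le
  have hr : M ≤ 23 / 21 * M := by linarith
  -- the identity
  have hid := mult_box_identity (M := M) (a := M) hW₀ hG hP (contDiff_nProfileR M) (contDiff_nProfileT M)
    contDiff_nProfileW ht hr hbox
  -- smoothness / continuity of the densities on `W₀`
  obtain ⟨cD, cFl, -, cB⟩ := contDiffOn_mult (M := M) (a := M) hW₀ hG (contDiff_nProfileR M) (contDiff_nProfileT M)
    contDiff_nProfileW
  have h0 := contDiffOn_pd hW₀ hG 0
  have h1 := contDiffOn_pd hW₀ hG 1
  have h2 := contDiffOn_pd hW₀ hG 2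
  have hc : ∀ j : Fin 4, ContDiffOn ℝ ∞ (fun q : E4 ↦ q j) W₀ := fun j ↦ (contDiff_coord j).contDiffOn
  have hsin : ContDiffOn ℝ ∞ (fun q : E4 ↦ sin (q 2)) W₀ := contDiff_sin.comp_contDiffOn (hc 2)
  have hcos : ContDiffOn ℝ ∞ (fun q : E4 ↦ cos (q 2)) W₀ := contDiff_cos.comp_contDiffOn (hc 2)
  have hSig : ContDiffOn ℝ ∞ (fun q : E4 ↦ q 1 ^ 2 + M ^ 2 * cos (q 2) ^ 2 + 2 * M * q 1) W₀ :=
    (((hc 1).pow 2).add (contDiffOn_const.mul (hcos.pow 2))).add (contDiffOn_const.mul (hc 1))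
  have hhq : ContDiffOn ℝ ∞ (fun q : E4 ↦ 20 * q 1 - 37 / 2 * M) W₀ := (contDiffOn_const.mul (hc 1)).sub contDiffOn_const
  have cLow : ContinuousOn (nEnergyLower M G) W₀ := by
    refine ContDiffOn.continuousOn (𝕜 := ℝ) (n := ∞) ?_
    unfold nEnergyLower
    exact hsin.mul ((((contDiffOn_const.mul (h1.pow 2)).add (((hhq.mul hSig).div_const 16).mul (h0.pow 2))).add
      ((contDiffOn_const.mul hhq).mul (h2.pow 2))))
  have cZ : ContinuousOn (nEnergyZeroth M G) W₀ := by
    refine ContDiffOn.continuousOn (𝕜 := ℝ) (n := ∞) ?_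
    unfold nEnergyZeroth
    exact (contDiffOn_const.mul hsin).mul (((((contDiffOn_const.mul (hc 1)).mul hG).mul h1).add
      (contDiffOn_const.mul (hG.pow 2))).sub ((hSig.mul hG).mul h0))
  have cBL : ContinuousOn (nBulkLower M G) W₀ := by
    refine ContDiffOn.continuousOn (𝕜 := ℝ) (n := ∞) ?_
    unfold nBulkLower
    exact hsin.mul (((((contDiffOn_const.mul ((hc 1).sub contDiffOn_const)).mul ((hc 1).add contDiffOn_const)).mul
      (h1.pow 2)).add (contDiffOn_const.mul (h0.pow 2))).add (contDiffOn_const.mul (h2.pow 2)))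
  -- (a) the energy at `t₂` from below
  have hE2 : (∫ θ in (0 : ℝ)..π, ∫ r in M..(23 / 21 * M), (nEnergyLower M G (boxPoint φ₀ t₂ r θ) +
      nEnergyZeroth M G (boxPoint φ₀ t₂ r θ))) ≤
      ∫ θ in (0 : ℝ)..π, ∫ r in M..(23 / 21 * M), -multDensity M M (nProfileR M) (nProfileT M) nProfileW G (boxPoint φ₀ t₂ r θ) := by
    refine box2_integral_mono (F := fun q ↦ nEnergyLower M G q + nEnergyZeroth M G q)
      (G := fun q ↦ -multDensity M M (nProfileR M) (nProfileT M) nProfileW G q) (cLow.add cZ) cD.continuousOn.neg hr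
      (fun r hr' θ hθ ↦ hbox t₂ (right_mem_Icc.mpr ht) r hr' θ hθ) fun r hr' θ hθ ↦ ?_
    have hq := nEnergy_quadratic_ge hM G (q := boxPoint φ₀ t₂ r θ) (by simpa using hr'.1) (by simpa using hr'.2)
      (by simpa using hθ)
    simp only [nEnergyLower, nEnergyZeroth, boxPoint_apply_one, boxPoint_apply_two] at hq ⊢
    linarith
  -- (b) the bulk from below
  have hB : (∫ t in t₁..t₂, ∫ θ in (0 : ℝ)..π, ∫ r in M..(23 / 21 * M), nBulkLower M G (boxPoint φ₀ t r θ)) ≤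
      ∫ t in t₁..t₂, ∫ θ in (0 : ℝ)..π, ∫ r in M..(23 / 21 * M), -multBulk M M (nProfileR M) (nProfileT M) nProfileW G (boxPoint φ₀ t r θ) := by
    refine box3_integral_mono (F := nBulkLower M G) (G := fun q ↦ -multBulk M M (nProfileR M) (nProfileT M) nProfileW G q) cBL cB.neg ht hr hbox
      fun t ht' r hr' θ hθ ↦ ?_
    have hq := neg_multBulk_nCurrent_ge hM G (q := boxPoint φ₀ t r θ) (by simpa using hr'.1) (by simpa using hr'.2)
      (by simpa using hθ)
    simpa only [nBulkLower, boxPoint_apply_one, boxPoint_apply_two] using hq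
  -- (c) the horizon flux is non-negative
  have hH : 0 ≤ ∫ t in t₁..t₂, ∫ θ in (0 : ℝ)..π, multFluxR M M (nProfileR M) (nProfileT M) nProfileW G (boxPoint φ₀ t M θ) :=
    intervalIntegral.integral_nonneg ht fun t _ ↦ intervalIntegral.integral_nonneg hπ fun θ hθ ↦
      multFluxR_nCurrent_horizon_nonneg hM.le G (boxPoint_apply_one φ₀ t M θ) (by simpa using hθ)
  -- split the integral in (a)
  have hsplit := box2_integral_add (t := t₂) (φ₀ := φ₀) cLow cZ hr
    (fun r hr' θ hθ ↦ hbox t₂ (right_mem_Icc.mpr ht) r hr' θ hθ)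
  rw [hsplit] at hE2
  -- normalise: integrals of negatives and the split flux
  have hflux := flux2_integral_sub (F := multFluxR M M (nProfileR M) (nProfileT M) nProfileW G)
    cFl.continuousOn ht hr hbox
  simp only [intervalIntegral.integral_neg] at hE2 hB ⊢
  rw [hflux] at hid
  linarith

end Estimate

end StarCoord

end Kerr

end Literature.Geometry.Lorentzian

end
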